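import Summits.Ventures.CertifiedManyBodySolver.Theorems.M3x2EdgeSplitSymReplayOutRouteEtaKron
import HarnessLib

/-!
# SymReplay checker — «ηκ-LINEAR», part A: the Kronecker number is LINEAR in the row; re-tagging and bound lemmas

(team lb-sym, cell hub-lb; hub-lb-sym-eng-4 g4, 2026-08-28; ADDITIVE on `…OutRouteEtaKron` (ηκ, p674232), on hub-lb-sym-eng-3's η modules
(`tagRep`, `wsortK`/`wgroupK`, `accZ`/`daccZ`, `rowCoefZ`) and on `…OutRouteMFD`/`…OutRouteMFK` (`rowOKZ`, `blockAbsBound`); nothing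
landed is touched.)

WHY.  ηκ (part `…OutRouteEtaKron`) encodes every row of the η word-level tables (Σ(W+S)·r ≈ 2.9e7 entries per E₁ module, measured
1.27 µs/entry interpreted) after building them densely (0.94 µs per term-entry).  The Kronecker number `Σᵢ uᵢ Xⁱ` is LINEAR in the
row, and a word-level row is an integer combination `Σ c · Lz` of ELEMENT rows; so the word-level Kronecker numbers can be accumulated
from element rows encoded ONCE (Σ n·r ≈ 2.3e6 entries) with O(1) big-integer work per tagged term — no dense table, no per-row encoding.
This part proves the identities and bounds that make the linear path LIST-EQUAL to ηκ's tables; part B (`…OutRouteEtaKronLinB`) builds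
the enumerator and the bridge.

WHAT.  (a) `wsortK`/`wgroupK` commute with re-tagging the row payload (`wsortK_map`, `wgroupK_map`; keys read words only) and groups
are drawn from the list (`mem_of_mem_wgroupK`); a generic tagged-basis flattener `wflatG` (= `wflatZ`, `wflatD`, … by `rfl`) with its
map/membership lemmas.  (b) Weighted column sums: `wsumZ φ n rz = Σ_{k<n} rowCoefZ rz k · φ k` (`sum_range_rowCoefZ`) and the swap
`Σ_{k<n} accZ ch k · φ k = Σ_{y ∈ ch} c_y · wsumZ φ n Lz_y` (`sum_range_accZ`).  (c) The encoders as INTEGER polynomials: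
`(evalLEoff X M u : ℤ) = polyZ X u + M · onesZ X |u|` and `(evalBEoff X M u : ℤ) = hornerZ X u + M · onesZ X |u|` for entries `≥ −M`, with
`polyZ`/`hornerZ` of a `List.range` map as weighted sums (`polyZ_map_range`, `hornerZ_map_range`).  (d) Bounds: strictly ascending
columns (`rowOKZ`) ⇒ `|rowCoefZ rz k| ≤ A` whenever every entry is `≤ A` in absolute value; `|accZ ch k| ≤ A · Σ |c|`.
Standard axioms; no `native_decide`; no executable of record changes.

HONEST FRAMING: list/arithmetic lemmas for an interpreted replay-COST lever; certifies nothing; no bound of record moves; tree floor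
(8,⅞,0) −0.8942613047 (rung V, computational) unchanged; #529 −0.8295699476 outside Lean; `LowerEdge_ge_m83o100` met BY VALUE only,
un-landed; no summit or crux statement is proved here; nothing here predicts superconductivity.
-/

namespace Summit.Ventures.CertifiedManyBodySolver.Theorems.SymReplay

open Literature.Probability.LatticeModels

/-! ##### (a) re-tagging the row payload; generic flattener; group membership -/

section Retag

/-- Generic tagged basis terms `(row_j, (c', w))` for every term of every basis polynomial (`wflatZ`/`wflatD`/`wflatK` are instances). -/
def wflatG {ρ : Type} (q : List (QPoly × ρ)) : List (ρ × (ℚ × Word)) :=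
  q.flatMap fun b => b.1.map fun t' => (b.2, t')

/-- `wflatZ` is the generic flattener on integer rows. -/
theorem wflatZ_eq_wflatG (qr : List (QPoly × List (ℤ × ℕ))) : wflatZ qr = wflatG qr := rfl

/-- The flattener commutes with re-tagging the row payload. -/
theorem wflatG_map {ρ ρ' : Type} (g : ρ → ρ') : ∀ (q : List (QPoly × ρ)),
    wflatG (q.map fun b => (b.1, g b.2)) = (wflatG q).map fun x => (g x.1, x.2)
  | [] => rfl
  | b :: q => by
    have ih := wflatG_map g q
    simp only [wflatG, List.map_cons, List.flatMap_cons, List.map_append, List.map_map] at ih ⊢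
    rw [ih]
    rfl

/-- Rows of flattened basis terms are rows of the zipped list. -/
theorem mem_wflatG {ρ : Type} {q : List (QPoly × ρ)} {x : ρ × (ℚ × Word)} (h : x ∈ wflatG q) :
    ∃ b ∈ q, x.1 = b.2 ∧ x.2 ∈ b.1 := by
  simp only [wflatG, List.mem_flatMap, List.mem_map] at h
  obtain ⟨b, hb, t', ht', rfl⟩ := h
  exact ⟨b, hb, rfl, ht'⟩

/-- The packed words (with coefficients) of a tagged list do not see the row payload. -/
theorem pwordsOf_map {ρ ρ' : Type} (lo hi : ℤ × ℤ) (g : ρ → ρ') (L : List (ρ × (ℚ × Word))) :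
    pwordsOf lo hi (L.map fun y => (g y.1, y.2)) = pwordsOf lo hi L := by
  simp [pwordsOf, List.map_map, Function.comp_def]

/-- **Keyed word sort commutes with re-tagging the row payload** (keys and comparator read words only). -/
theorem wsortK_map {ρ ρ' : Type} (lo hi : ℤ × ℤ) (g : ρ → ρ') (L : List (ρ × (ℚ × Word))) :
    wsortK lo hi (L.map fun y => (g y.1, y.2)) = (wsortK lo hi L).map fun y => (g y.1, y.2) := by
  unfold wsortK keyPows
  rw [pwordsOf_map]
  set pows := PackedNF.powsB (PackedNF.maxCode (pwordsOf lo hi L) + 2) (PackedNF.maxLen (pwordsOf lo hi L))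
  have hdec : (L.map fun y => (g y.1, y.2)).map (decK lo hi pows) =
      (L.map (decK lo hi pows)).map fun p => (p.1, (g p.2.1, p.2.2)) := by
    simp [List.map_map, Function.comp_def, decK]
  have hms : ((L.map (decK lo hi pows)).map fun p => (p.1, (g p.2.1, p.2.2))).mergeSort (fun a b => !decide (b.1 < a.1)) =
      ((L.map (decK lo hi pows)).mergeSort fun a b => !decide (b.1 < a.1)).map fun p => (p.1, (g p.2.1, p.2.2)) :=
    (List.map_mergeSort (l := L.map (decK lo hi pows)) (f := fun p => (p.1, (g p.2.1, p.2.2)))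
      (r := fun a b => !decide (b.1 < a.1)) (s := fun a b => !decide (b.1 < a.1)) (fun _ _ _ _ => rfl)).symm
  rw [hdec, hms, List.map_map, List.map_map]
  rfl

/-- **Keyed grouping commutes with re-tagging the row payload.** -/
theorem wgroupK_map {ρ ρ' : Type} (lo hi : ℤ × ℤ) (g : ρ → ρ') (L : List (ρ × (ℚ × Word))) :
    wgroupK lo hi (L.map fun y => (g y.1, y.2)) = (wgroupK lo hi L).map (List.map fun y => (g y.1, y.2)) := by
  rw [wgroupK, wgroupK, wsortK_map]
  exact splitBy_map _ _ _ (fun _ _ => rfl) _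

/-- The keyed sort is a permutation of the list. -/
theorem wsortK_perm {ρ : Type} (lo hi : ℤ × ℤ) (L : List (ρ × (ℚ × Word))) : (wsortK lo hi L).Perm L := by
  unfold wsortK
  have h := (List.mergeSort_perm (L.map (decK lo hi (keyPows lo hi L))) fun a b => !decide (b.1 < a.1)).map Prod.snd
  rw [List.map_map, List.map_id'' (f := Prod.snd ∘ decK lo hi (keyPows lo hi L)) (fun _ => rfl)] at h
  exact h

/-- **Every member of a keyed group is a term of the list.** -/
theorem mem_of_mem_wgroupK {ρ : Type} (lo hi : ℤ × ℤ) {L : List (ρ × (ℚ × Word))} {ch : List (ρ × (ℚ × Word))}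
    (hch : ch ∈ wgroupK lo hi L) {y : ρ × (ℚ × Word)} (hy : y ∈ ch) : y ∈ L := by
  have h1 : y ∈ (wgroupK lo hi L).flatten := List.mem_flatten.2 ⟨ch, hch, hy⟩
  rw [wgroupK, List.flatten_splitBy] at h1
  exact (wsortK_perm lo hi L).mem_iff.1 h1

end Retag

/-! ##### (b) weighted column sums of sparse rows and of group accumulations -/

section Sums

/-- Sum over `List.range (n+1)` = sum over `List.range n` plus the last term. -/
theorem lsum_range_succ (f : ℕ → ℤ) (n : ℕ) :
    ((List.range (n + 1)).map f).sum = ((List.range n).map f).sum + f n := by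
  rw [List.range_succ, List.map_append, List.sum_append, List.map_singleton, List.sum_singleton]

/-- A one-point indicator summed over `range n` picks the point (or nothing). -/
theorem lsum_range_ite (n a : ℕ) (v : ℤ) (φ : ℕ → ℤ) :
    ((List.range n).map fun k => (if a = k then v else 0) * φ k).sum = if a < n then v * φ a else 0 := by
  induction n with
  | zero => simp
  | succ n ih =>
    rw [lsum_range_succ, ih]
    by_cases h1 : a < n
    · rw [if_pos h1, if_neg (by omega), zero_mul, add_zero, if_pos (by omega)]
    · rw [if_neg h1, zero_add]
      by_cases h2 : a = n
      · subst h2; rw [if_pos rfl, if_pos (Nat.lt_succ_self _)]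
      · rw [if_neg h2, zero_mul, if_neg (by omega)]

/-- **Weighted sparse-row sum** `Σ_{(a,k) ∈ rz, k < n} a · φ k` (the executable shape; `φ k = X^k`, `X^(n−1−k)`, `1`). -/
def wsumZ (φ : ℕ → ℤ) (n : ℕ) (rz : List (ℤ × ℕ)) : ℤ := (rz.map fun e => if e.2 < n then e.1 * φ e.2 else 0).sum

/-- `wsumZ` of a cons. -/
theorem wsumZ_cons (φ : ℕ → ℤ) (n : ℕ) (e : ℤ × ℕ) (rz : List (ℤ × ℕ)) :
    wsumZ φ n (e :: rz) = (if e.2 < n then e.1 * φ e.2 else 0) + wsumZ φ n rz := by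
  rw [wsumZ, wsumZ, List.map_cons, List.sum_cons]

/-- Sums of sums over `range n`. -/
theorem lsum_range_add (f g : ℕ → ℤ) (n : ℕ) :
    ((List.range n).map fun k => f k + g k).sum = ((List.range n).map f).sum + ((List.range n).map g).sum := by
  induction n with
  | zero => simp
  | succ n ih => rw [lsum_range_succ, lsum_range_succ, lsum_range_succ, ih]; ring

/-- Scalars come out of sums over `range n`. -/
theorem lsum_range_mul (c : ℤ) (f : ℕ → ℤ) (n : ℕ) :
    ((List.range n).map fun k => c * f k).sum = c * ((List.range n).map f).sum := by
  induction n with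
  | zero => simp
  | succ n ih => rw [lsum_range_succ, lsum_range_succ, ih]; ring

/-- **The dense column function of a sparse row, weighted and summed over `range n`, IS `wsumZ`.** -/
theorem sum_range_rowCoefZ (φ : ℕ → ℤ) (n : ℕ) : ∀ (rz : List (ℤ × ℕ)),
    ((List.range n).map fun k => rowCoefZ rz k * φ k).sum = wsumZ φ n rz
  | [] => by
    rw [wsumZ, List.map_nil, List.sum_nil]
    have : (fun k => rowCoefZ [] k * φ k) = fun _ => (0 : ℤ) := by funext k; simp [rowCoefZ]
    rw [this]; simp
  | e :: rz => by
    have ih := sum_range_rowCoefZ φ n rz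
    have hsplit : (fun k => rowCoefZ (e :: rz) k * φ k) = fun k => (if e.2 = k then e.1 else 0) * φ k + rowCoefZ rz k * φ k := by
      funext k; rw [rowCoefZ_cons]; ring
    rw [hsplit, lsum_range_add, ih, lsum_range_ite, wsumZ_cons]

/-- **Swap**: the group accumulation's columns, weighted and summed over `range n`, IS the coefficient combination of the terms' `wsumZ`. -/
theorem sum_range_accZ (φ : ℕ → ℤ) (n : ℕ) : ∀ (ch : List (List (ℤ × ℕ) × (ℚ × Word))),
    ((List.range n).map fun k => accZ ch k * φ k).sum = (ch.map fun y => y.2.1.num * wsumZ φ n y.1).sum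
  | [] => by
    rw [List.map_nil, List.sum_nil]
    have : (fun k => accZ [] k * φ k) = fun _ => (0 : ℤ) := by funext k; simp [accZ]
    rw [this]; simp
  | y :: ch => by
    have ih := sum_range_accZ φ n ch
    have hsplit : (fun k => accZ (y :: ch) k * φ k) = fun k => y.2.1.num * (rowCoefZ y.1 k * φ k) + accZ ch k * φ k := by
      funext k; rw [accZ_cons]; ring
    rw [hsplit, lsum_range_add, lsum_range_mul, sum_range_rowCoefZ, ih, List.map_cons, List.sum_cons]

/-- The plain sum of a `range`-map equals the weighted sum with weight `1`. -/
theorem lsum_range_eq_weighted (f : ℕ → ℤ) (n : ℕ) :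
    ((List.range n).map f).sum = ((List.range n).map fun k => f k * 1).sum := by simp

end Sums

/-! ##### (c) the encoders as integer polynomials -/

section Poly

/-- `Σ_{i<n} X^i` as an integer (executable; once per block). -/
def onesZ (X n : ℕ) : ℤ := ((List.range n).map fun i => (X : ℤ) ^ i).sum

/-- Little-endian integer polynomial `Σᵢ uᵢ X^i` (recursion of `evalLE`). -/
def polyZ (X : ℕ) : List ℤ → ℤ
  | [] => 0
  | x :: xs => x + (X : ℤ) * polyZ X xs

/-- Big-endian integer Horner fold `Σᵢ uᵢ X^(r−1−i)` (recursion of `evalBEoff`). -/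
def hornerZ (X : ℕ) (u : List ℤ) : ℤ := u.foldl (fun acc x => acc * (X : ℤ) + x) 0

/-- `onesZ` satisfies the little-endian recursion. -/
theorem onesZ_succ (X n : ℕ) : onesZ X (n + 1) = 1 + (X : ℤ) * onesZ X n := by
  rw [onesZ, onesZ, List.range_succ_eq_map, List.map_cons, List.sum_cons, pow_zero, List.map_map]
  congr 1
  have : ((fun i => (X : ℤ) ^ i) ∘ Nat.succ) = fun i => (X : ℤ) * (X : ℤ) ^ i := by funext i; simp [pow_succ, mul_comm]
  rw [this, List.sum_map_mul_left]

/-- `onesZ` gains the top power. -/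
theorem onesZ_succ_top (X n : ℕ) : onesZ X (n + 1) = onesZ X n + (X : ℤ) ^ n := by
  rw [onesZ, onesZ]; exact lsum_range_succ _ n

/-- **The little-endian offset encoder as an integer**: `evalLEoff X M u = polyZ X u + M · onesZ X |u|` for entries `≥ −M`. -/
theorem evalLEoff_int (X : ℕ) (M : ℤ) : ∀ (u : List ℤ), (∀ x ∈ u, -M ≤ x) →
    (evalLEoff X M u : ℤ) = polyZ X u + M * onesZ X u.length
  | [], _ => by simp [evalLEoff, polyZ, onesZ]
  | x :: xs, h => by
    have hx : 0 ≤ x + M := by have := h x List.mem_cons_self; omega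
    have ih := evalLEoff_int X M xs fun z hz => h z (List.mem_cons_of_mem _ hz)
    rw [evalLEoff, polyZ, List.length_cons, onesZ_succ]
    push_cast
    rw [Int.toNat_of_nonneg hx, ih]
    ring

/-- The big-endian Horner fold with a general accumulator, as an integer. -/
theorem foldl_hornerOff_int (X : ℕ) (M : ℤ) : ∀ (u : List ℤ) (a : ℕ) (a' t : ℤ), (∀ x ∈ u, -M ≤ x) → (a : ℤ) = a' + M * t →
    ((u.foldl (fun acc x => acc * X + (x + M).toNat) a : ℕ) : ℤ) =
      u.foldl (fun acc x => acc * (X : ℤ) + x) a' + M * (t * (X : ℤ) ^ u.length + onesZ X u.length)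
  | [], a, a', t, _, ha => by simp [onesZ, ha]
  | x :: xs, a, a', t, h, ha => by
    have hx : 0 ≤ x + M := by have := h x List.mem_cons_self; omega
    rw [List.foldl_cons, List.foldl_cons, List.length_cons,
      foldl_hornerOff_int X M xs _ (a' * X + x) (t * X + 1) (fun z hz => h z (List.mem_cons_of_mem _ hz)) (by
        push_cast; rw [Int.toNat_of_nonneg hx, ha]; ring),
      onesZ_succ_top]
    ring

/-- **The big-endian offset encoder as an integer**: `evalBEoff X M u = hornerZ X u + M · onesZ X |u|` for entries `≥ −M`. -/
theorem evalBEoff_int (X : ℕ) (M : ℤ) (u : List ℤ) (h : ∀ x ∈ u, -M ≤ x) :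
    (evalBEoff X M u : ℤ) = hornerZ X u + M * onesZ X u.length := by
  rw [evalBEoff, hornerZ, foldl_hornerOff_int X M u 0 0 0 h (by simp)]
  ring

/-- `polyZ` of a `range`-map is the little-endian weighted sum. -/
theorem polyZ_map_range (X : ℕ) : ∀ (n : ℕ) (f : ℕ → ℤ),
    polyZ X ((List.range n).map f) = ((List.range n).map fun k => f k * (X : ℤ) ^ k).sum
  | 0, f => by simp [polyZ]
  | n + 1, f => by
    rw [List.range_succ_eq_map, List.map_cons, polyZ, List.map_map, List.map_cons, List.sum_cons, pow_zero, mul_one,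
      List.map_map, polyZ_map_range X n (f ∘ Nat.succ)]
    congr 1
    have : ((fun k => f k * (X : ℤ) ^ k) ∘ Nat.succ) = fun k => (X : ℤ) * ((f ∘ Nat.succ) k * (X : ℤ) ^ k) := by
      funext k; simp [pow_succ]; ring
    rw [this, List.sum_map_mul_left]

/-- `hornerZ` of a `range`-map is the big-endian weighted sum. -/
theorem hornerZ_map_range (X : ℕ) : ∀ (n : ℕ) (f : ℕ → ℤ),
    hornerZ X ((List.range n).map f) = ((List.range n).map fun k => f k * (X : ℤ) ^ (n - 1 - k)).sum
  | 0, f => by simp [hornerZ]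
  | n + 1, f => by
    have ih := hornerZ_map_range X n f
    rw [hornerZ] at ih ⊢
    rw [List.range_succ, List.map_append, List.foldl_append, ih, List.map_singleton, List.foldl_cons, List.foldl_nil,
      List.map_append, List.sum_append, List.map_singleton, List.sum_singleton, show n + 1 - 1 - n = 0 by omega, pow_zero,
      mul_one, ← List.sum_map_mul_right]
    refine congrArg (fun s => s + f n) (congrArg List.sum (List.map_congr_left fun k hk => ?_))
    rw [List.mem_range] at hk
    rw [show n + 1 - 1 - k = (n - 1 - k) + 1 by omega, pow_succ, mul_assoc]

/-- The entry sum of a `range`-map. -/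
theorem sum_map_range_eq (n : ℕ) (f : ℕ → ℤ) : ((List.range n).map f).sum = ((List.range n).map fun k => f k * 1).sum := by simp

end Poly

/-! ##### (d) bounds: strictly ascending columns ⇒ column coefficients bounded by the entry bound -/

section Bounds

/-- `colsAscLt k rz N`: every column is `≥ k` and the columns are strictly increasing. -/
theorem colsAscLt_spec : ∀ (k : ℕ) (rz : List (ℤ × ℕ)) (N : ℕ), colsAscLt k rz N = true →
    (∀ e ∈ rz, k ≤ e.2) ∧ (rz.map Prod.snd).Pairwise (· < ·)
  | k, [], N, _ => by simp
  | k, (a, i) :: r, N, h => by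
    simp only [colsAscLt, Bool.and_eq_true, decide_eq_true_eq] at h
    obtain ⟨⟨hki, _⟩, hr⟩ := h
    obtain ⟨hge, hpw⟩ := colsAscLt_spec (i + 1) r N hr
    refine ⟨fun e he => ?_, ?_⟩
    · rcases List.mem_cons.1 he with rfl | he
      · exact hki
      · exact le_trans (by omega) (hge e he)
    · rw [List.map_cons, List.pairwise_cons]
      exact ⟨fun j hj => by
        obtain ⟨e, he, rfl⟩ := List.mem_map.1 hj
        have := hge e he; omega, hpw⟩

/-- A column absent from the row has coefficient `0`. -/
theorem rowCoefZ_eq_zero_of_not_mem : ∀ (rz : List (ℤ × ℕ)) (k : ℕ), k ∉ rz.map Prod.snd → rowCoefZ rz k = 0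
  | [], k, _ => by simp [rowCoefZ]
  | e :: r, k, h => by
    rw [List.map_cons, List.mem_cons, not_or] at h
    rw [rowCoefZ_cons, rowCoefZ_eq_zero_of_not_mem r k h.2, if_neg (fun h' => h.1 h'.symm), add_zero]

/-- **With pairwise-distinct columns, every column coefficient is bounded by the entry bound.** -/
theorem abs_rowCoefZ_le : ∀ (rz : List (ℤ × ℕ)) (A : ℤ), (rz.map Prod.snd).Pairwise (· < ·) → (∀ e ∈ rz, |e.1| ≤ A) → 0 ≤ A →
    ∀ k, |rowCoefZ rz k| ≤ A
  | [], A, _, _, hA => fun k => by simpa [rowCoefZ] using hA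
  | e :: r, A, hpw, hb, hA => fun k => by
    rw [List.map_cons, List.pairwise_cons] at hpw
    rw [rowCoefZ_cons]
    by_cases hek : e.2 = k
    · have hnot : k ∉ r.map Prod.snd := fun hk => by have := hpw.1 k hk; omega
      rw [if_pos hek, rowCoefZ_eq_zero_of_not_mem r k hnot, add_zero]
      exact hb e List.mem_cons_self
    · rw [if_neg hek, zero_add]
      exact abs_rowCoefZ_le r A hpw.2 (fun e' he' => hb e' (List.mem_cons_of_mem _ he')) hA k

/-- `Σ |c.num|` over a group (the per-word coefficient mass). -/
def cabsSum {ρ : Type} (ch : List (ρ × (ℚ × Word))) : ℤ := (ch.map fun y => |y.2.1.num|).sum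

/-- `cabsSum` of a cons. -/
theorem cabsSum_cons {ρ : Type} (y : ρ × (ℚ × Word)) (ch : List (ρ × (ℚ × Word))) :
    cabsSum (y :: ch) = |y.2.1.num| + cabsSum ch := by rw [cabsSum, cabsSum, List.map_cons, List.sum_cons]

/-- `cabsSum` is nonnegative. -/
theorem cabsSum_nonneg {ρ : Type} : ∀ (ch : List (ρ × (ℚ × Word))), 0 ≤ cabsSum ch
  | [] => by simp [cabsSum]
  | y :: ch => by rw [cabsSum_cons]; exact add_nonneg (abs_nonneg _) (cabsSum_nonneg ch)

/-- `cabsSum` does not see the row payload. -/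
theorem cabsSum_map {ρ ρ' : Type} (g : ρ → ρ') (ch : List (ρ × (ℚ × Word))) :
    cabsSum (ch.map fun y => (g y.1, y.2)) = cabsSum ch := by
  simp [cabsSum, List.map_map, Function.comp_def]

/-- **Group accumulation bound**: rows with bounded column coefficients ⇒ `|accZ ch k| ≤ A · Σ |c.num|`. -/
theorem abs_accZ_le (A : ℤ) (hA : 0 ≤ A) : ∀ (ch : List (List (ℤ × ℕ) × (ℚ × Word))), (∀ y ∈ ch, ∀ k, |rowCoefZ y.1 k| ≤ A) →
    ∀ k, |accZ ch k| ≤ A * cabsSum ch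
  | [], _ => fun k => by simp [accZ, cabsSum]
  | y :: ch, h => fun k => by
    rw [accZ_cons, cabsSum_cons, mul_add]
    have h1 : |y.2.1.num * rowCoefZ y.1 k| ≤ A * |y.2.1.num| := by
      rw [abs_mul, mul_comm A]
      exact mul_le_mul_of_nonneg_left (h y List.mem_cons_self k) (abs_nonneg _)
    have h2 := abs_accZ_le A hA ch (fun y' hy' => h y' (List.mem_cons_of_mem _ hy')) k
    exact le_trans (abs_add_le _ _) (add_le_add h1 h2)

end Bounds

end Summit.Ventures.CertifiedManyBodySolver.Theorems.SymReplay
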